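import Summits.RiemannHypothesis.RiemannHypothesis.Theorems.TiltedLandingLaw421FieldSplitNodeB

/-! # TiltedLandingLaw421MonovariantSocketA
c13 MONOVARIANT socket §M (C1 rh-idea-5 g19): `LevelMeter`, `MonovariantInitG/StepG`, literal `MonovariantInit/Step`, K glue `denseLevelCensusLow_of_monovariant` (telescoping) and converse `monovariant_of_denseLevelCensusLow`.
SUPPORT module for crux `TiltedLandingLaw421` (stmt-RiemannHypothesis-24774), `--supports` only: proves no stub, no crux; fully proved (no `sorry`).
Packaged by C4 rh-idea-6 g21 per director (CA239)(1) in the (CA237) lint shape. RH is not proved. -/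

namespace RhW07.C12.FieldSplit

open Complex
open RhIdea6.G17.W07C7 RhIdea6.G17.W07C7.Rev6 RhIdea6.G18.W07C8.Law421BirthS RhIdea6.G19.W07C11.Seam
open RhIdea6.G20.W07C12.Frac RhIdea6.G20.W07C12.StColP

/-- a LEVEL METER: one real number per datum `(η, f, x₀, s, hmax, R, Hs, B)` and level `j`. -/
abbrev LevelMeter : Type := ℝ → (ℂ → ℂ) → ℝ → ℝ → ℝ → ℝ → ℝ → ℕ → ℕ → ℝ

/-- **(β2′) generic** `MonovariantInit`: the meter starts inside the purse. -/
def MonovariantInitG (cE : ℝ) (M : LevelMeter) : Prop :=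
  ∀ (η : ℝ) (f : ℂ → ℂ) (x₀ s hmax R Hs : ℝ) (B : ℕ), EngineHyps5 2 η f x₀ s hmax R Hs B →
    M η f x₀ s hmax R Hs B 0 ≤ (Hs / s) ^ 2 + B + cE

/-- **(β1′) generic** `MonovariantStep`: `M ≥ 0`, non-increasing, and a UNIT-PLUS-LIFT decrement (with successors inside the lift) at every level whose
lowest tracked not-ready state is not `P`-certified. -/
def MonovariantStepG (μ : ℝ) (P St Ready : StatePred) (M : LevelMeter) : Prop :=
  ∀ (η : ℝ) (f : ℂ → ℂ) (x₀ s hmax R Hs : ℝ) (B : ℕ), EngineHyps5 2 η f x₀ s hmax R Hs B →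
    (∀ j : ℕ, 0 ≤ M η f x₀ s hmax R Hs B j) ∧ (∀ j : ℕ, M η f x₀ s hmax R Hs B (j + 1) ≤ M η f x₀ s hmax R Hs B j) ∧
    ∀ j : ℕ, (∃ v : ℂ, IsLowest St η f x₀ s hmax R Hs B j v ∧ ¬ Ready η f x₀ s hmax R Hs B j v ∧ ¬ P η f x₀ s hmax R Hs B j v) →
      ∃ lam : ℝ, 0 ≤ lam ∧
        (∀ u : ℂ, St η f x₀ s hmax R Hs B j u → ¬ Ready η f x₀ s hmax R Hs B j u →
          ∃ u' : ℂ, St η f x₀ s hmax R Hs B (j + 1) u' ∧ |u'.im| ≤ |u.im| + lam) ∧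
        M η f x₀ s hmax R Hs B (j + 1) + 1 + lam / (μ * s) ≤ M η f x₀ s hmax R Hs B j

/-- ★ **(γ′, K) telescoping:** (β2′) ∧ (β1′) ⇒ the priced stopped census (β-low). -/
theorem denseLevelCensusLow_of_monovariant {μ cE : ℝ} (hμ : 0 < μ) {P St Ready : StatePred} {M : LevelMeter}
    (hI : MonovariantInitG cE M) (hS : MonovariantStepG μ P St Ready M) : DenseLevelCensusLow μ cE P St Ready := by
  intro η f x₀ s hmax R Hs B hE
  classical
  have hs : 0 < s := hE.2.2.2.1
  have hμs : 0 < μ * s := mul_pos hμ hs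
  obtain ⟨hM0, hmono, hstep⟩ := hS η f x₀ s hmax R Hs B hE
  have hinit := hI η f x₀ s hmax R Hs B hE
  -- the meter at this datum, the charged levels, the lifts
  set Mj : ℕ → ℝ := fun j => M η f x₀ s hmax R Hs B j with hMj_def
  set Ch : ℕ → Prop := fun j =>
    ∃ v : ℂ, IsLowest St η f x₀ s hmax R Hs B j v ∧ ¬ Ready η f x₀ s hmax R Hs B j v ∧ ¬ P η f x₀ s hmax R Hs B j v with hCh_def
  have hstep' : ∀ j : ℕ, Ch j → ∃ lam : ℝ, 0 ≤ lam ∧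
      (∀ u : ℂ, St η f x₀ s hmax R Hs B j u → ¬ Ready η f x₀ s hmax R Hs B j u →
        ∃ u' : ℂ, St η f x₀ s hmax R Hs B (j + 1) u' ∧ |u'.im| ≤ |u.im| + lam) ∧
      Mj (j + 1) + 1 + lam / (μ * s) ≤ Mj j := fun j hj => hstep j hj
  let lamf : ℕ → ℝ := fun j => if h : Ch j then Classical.choose (hstep' j h) else 0
  have hlam0 : ∀ j, 0 ≤ lamf j := by
    intro j
    by_cases h : Ch j
    · simp only [lamf, dif_pos h]; exact (Classical.choose_spec (hstep' j h)).1
    · simp only [lamf, dif_neg h]; exact le_rfl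
  have hdec : ∀ j, Ch j → Mj (j + 1) + 1 + lamf j / (μ * s) ≤ Mj j := by
    intro j h
    simp only [lamf, dif_pos h]
    exact (Classical.choose_spec (hstep' j h)).2.2
  have hsucc : ∀ j, Ch j → ∀ u : ℂ, St η f x₀ s hmax R Hs B j u → ¬ Ready η f x₀ s hmax R Hs B j u →
      ∃ u' : ℂ, St η f x₀ s hmax R Hs B (j + 1) u' ∧ |u'.im| ≤ |u.im| + lamf j := by
    intro j h u hu hR
    simp only [lamf, dif_pos h]
    exact (Classical.choose_spec (hstep' j h)).2.1 u hu hR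
  have hmono' : ∀ j, Mj (j + 1) ≤ Mj j := fun j => hmono j
  have hM0' : ∀ j, 0 ≤ Mj j := fun j => hM0 j
  have hanti : Antitone Mj := antitone_nat_of_succ_le hmono'
  have hdrop : ∀ j, Ch j → Mj (j + 1) + 1 ≤ Mj j := by
    intro j h
    have h1 := hdec j h
    have h2 : 0 ≤ lamf j / (μ * s) := div_nonneg (hlam0 j) hμs.le
    linarith
  -- (1) telescoping over an initial segment of levels
  have htel : ∀ n : ℕ, (((Finset.range n).filter Ch).card : ℝ) + (∑ e ∈ (Finset.range n).filter Ch, lamf e) / (μ * s)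
      ≤ Mj 0 - Mj n := by
    intro n
    induction n with
    | zero => simp
    | succ n ih =>
      rw [Finset.range_add_one, Finset.filter_insert]
      by_cases h : Ch n
      · rw [if_pos h]
        have hnot : n ∉ (Finset.range n).filter Ch := by simp
        rw [Finset.card_insert_of_notMem hnot, Finset.sum_insert hnot, add_div]
        push_cast
        have := hdec n h
        linarith
      · rw [if_neg h]
        have := hmono' n
        linarith
  -- (2) the charged levels are FINITE: `j ↦ ⌊M j⌋` is injective on them with values in `[0, ⌊M 0⌋]`
  have hfin : Set.Finite {j : ℕ | Ch j} := by
    refine Set.Finite.of_finite_image (f := fun j : ℕ => ⌊Mj j⌋) ?_ ?_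
    · refine (Set.finite_Icc (0 : ℤ) ⌊Mj 0⌋).subset ?_
      rintro _ ⟨j, _, rfl⟩
      exact ⟨Int.floor_nonneg.mpr (hM0' j), Int.floor_mono (hanti (Nat.zero_le j))⟩
    · intro j hj j' hj' hjj'
      by_contra hne
      have key : ∀ a b : ℕ, Ch a → a < b → ⌊Mj b⌋ < ⌊Mj a⌋ := by
        intro a b ha hab
        have h1 : Mj b ≤ Mj (a + 1) := hanti (Nat.succ_le_of_lt hab)
        have h2 := hdrop a ha
        have h3 : Mj b + 1 ≤ Mj a := by linarith
        have h4 := Int.floor_mono h3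
        rw [Int.floor_add_one] at h4
        omega
      rcases lt_or_gt_of_ne hne with hlt | hlt
      · have := key j j' hj hlt
        simp only at hjj'
        omega
      · have := key j' j hj' hlt
        simp only at hjj'
        omega
  -- (3) the census
  set E : Finset ℕ := hfin.toFinset with hE_def
  have hmemE : ∀ j, j ∈ E ↔ Ch j := fun j => by rw [hE_def, Set.Finite.mem_toFinset]; rfl
  obtain ⟨n, hn⟩ : ∃ n : ℕ, E ⊆ (Finset.range n).filter Ch := by
    refine ⟨E.sup id + 1, fun j hj => ?_⟩
    rw [Finset.mem_filter, Finset.mem_range]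
    exact ⟨Nat.lt_succ_of_le (Finset.le_sup (f := id) hj), (hmemE j).mp hj⟩
  have hbound : (E.card : ℝ) + (∑ e ∈ E, lamf e) / (μ * s) ≤ (Hs / s) ^ 2 + B + cE := by
    have hc : (E.card : ℝ) ≤ ((Finset.range n).filter Ch).card := by exact_mod_cast Finset.card_le_card hn
    have hsum : (∑ e ∈ E, lamf e) ≤ ∑ e ∈ (Finset.range n).filter Ch, lamf e :=
      Finset.sum_le_sum_of_subset_of_nonneg hn fun e _ _ => hlam0 e
    have hdiv : (∑ e ∈ E, lamf e) / (μ * s) ≤ (∑ e ∈ (Finset.range n).filter Ch, lamf e) / (μ * s) :=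
      div_le_div_of_nonneg_right hsum hμs.le
    have := htel n
    have := hM0' n
    linarith
  refine ⟨E, lamf, hlam0, hbound, ?_, ?_⟩
  · intro j v hj hv hR
    by_contra hP
    exact hj ((hmemE j).mpr ⟨v, hv, hR, hP⟩)
  · intro j u hj hu hR
    exact hsucc j ((hmemE j).mp hj) u hu hR

/-- ★ (K, converse) every priced stopped census DEFINES a meter satisfying (β1′) ∧ (β2′) — the REMAINING CHARGE `M j := #{e ∈ E : j ≤ e} + Σ_{e ∈ E, j ≤ e} λ_e/(μ·s)`;
so with `M` abstract the monovariant sockets are EQUIVALENT to (β-low): the content of cycle 13 is the choice of `M`, not the glue. -/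
theorem monovariant_of_denseLevelCensusLow {μ cE : ℝ} (hμ : 0 < μ) {P St Ready : StatePred}
    (h : DenseLevelCensusLow μ cE P St Ready) : ∃ M : LevelMeter, MonovariantInitG cE M ∧ MonovariantStepG μ P St Ready M := by
  classical
  -- choose the census at every legal datum
  have hc : ∀ (η : ℝ) (f : ℂ → ℂ) (x₀ s hmax R Hs : ℝ) (B : ℕ) (hE : EngineHyps5 2 η f x₀ s hmax R Hs B),
      ∃ (E : Finset ℕ) (lam : ℕ → ℝ), (∀ j : ℕ, 0 ≤ lam j) ∧
        (E.card : ℝ) + (∑ e ∈ E, lam e) / (μ * s) ≤ (Hs / s) ^ 2 + B + cE ∧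
        (∀ (j : ℕ) (v : ℂ), j ∉ E → IsLowest St η f x₀ s hmax R Hs B j v → ¬ Ready η f x₀ s hmax R Hs B j v →
          P η f x₀ s hmax R Hs B j v) ∧
        (∀ (j : ℕ) (u : ℂ), j ∈ E → St η f x₀ s hmax R Hs B j u → ¬ Ready η f x₀ s hmax R Hs B j u →
          ∃ u' : ℂ, St η f x₀ s hmax R Hs B (j + 1) u' ∧ |u'.im| ≤ |u.im| + lam j) := fun η f x₀ s hmax R Hs B hE => h η f x₀ s hmax R Hs B hE
  -- the meter: remaining charge from level j on (0 off the legal data)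
  let Ef : ∀ (η : ℝ) (f : ℂ → ℂ) (x₀ s hmax R Hs : ℝ) (B : ℕ), EngineHyps5 2 η f x₀ s hmax R Hs B → Finset ℕ :=
    fun η f x₀ s hmax R Hs B hE => Classical.choose (hc η f x₀ s hmax R Hs B hE)
  let Lf : ∀ (η : ℝ) (f : ℂ → ℂ) (x₀ s hmax R Hs : ℝ) (B : ℕ), EngineHyps5 2 η f x₀ s hmax R Hs B → ℕ → ℝ :=
    fun η f x₀ s hmax R Hs B hE => Classical.choose (Classical.choose_spec (hc η f x₀ s hmax R Hs B hE))
  have hspec : ∀ (η : ℝ) (f : ℂ → ℂ) (x₀ s hmax R Hs : ℝ) (B : ℕ) (hE : EngineHyps5 2 η f x₀ s hmax R Hs B),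
      (∀ j : ℕ, 0 ≤ Lf η f x₀ s hmax R Hs B hE j) ∧
        ((Ef η f x₀ s hmax R Hs B hE).card : ℝ) + (∑ e ∈ Ef η f x₀ s hmax R Hs B hE, Lf η f x₀ s hmax R Hs B hE e) / (μ * s)
          ≤ (Hs / s) ^ 2 + B + cE ∧
        (∀ (j : ℕ) (v : ℂ), j ∉ Ef η f x₀ s hmax R Hs B hE → IsLowest St η f x₀ s hmax R Hs B j v →
          ¬ Ready η f x₀ s hmax R Hs B j v → P η f x₀ s hmax R Hs B j v) ∧
        (∀ (j : ℕ) (u : ℂ), j ∈ Ef η f x₀ s hmax R Hs B hE → St η f x₀ s hmax R Hs B j u → ¬ Ready η f x₀ s hmax R Hs B j u →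
          ∃ u' : ℂ, St η f x₀ s hmax R Hs B (j + 1) u' ∧ |u'.im| ≤ |u.im| + Lf η f x₀ s hmax R Hs B hE j) :=
    fun η f x₀ s hmax R Hs B hE => Classical.choose_spec (Classical.choose_spec (hc η f x₀ s hmax R Hs B hE))
  let M : LevelMeter := fun η f x₀ s hmax R Hs B j =>
    if hE : EngineHyps5 2 η f x₀ s hmax R Hs B then
      (((Ef η f x₀ s hmax R Hs B hE).filter (fun e => j ≤ e)).card : ℝ) +
        (∑ e ∈ (Ef η f x₀ s hmax R Hs B hE).filter (fun e => j ≤ e), Lf η f x₀ s hmax R Hs B hE e) / (μ * s)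
    else 0
  refine ⟨M, ?_, ?_⟩
  · intro η f x₀ s hmax R Hs B hE
    obtain ⟨_, hsum, _, _⟩ := hspec η f x₀ s hmax R Hs B hE
    have hfilt : (Ef η f x₀ s hmax R Hs B hE).filter (fun e => 0 ≤ e) = Ef η f x₀ s hmax R Hs B hE :=
      Finset.filter_true_of_mem fun e _ => Nat.zero_le e
    have hM : M η f x₀ s hmax R Hs B 0 =
        (((Ef η f x₀ s hmax R Hs B hE).filter (fun e => 0 ≤ e)).card : ℝ) +
          (∑ e ∈ (Ef η f x₀ s hmax R Hs B hE).filter (fun e => 0 ≤ e), Lf η f x₀ s hmax R Hs B hE e) / (μ * s) := by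
      simp only [M, dif_pos hE]
    rw [hM, hfilt]
    exact hsum
  · intro η f x₀ s hmax R Hs B hE
    have hs : 0 < s := hE.2.2.2.1
    have hμs : 0 < μ * s := mul_pos hμ hs
    have hMj : ∀ j : ℕ, M η f x₀ s hmax R Hs B j =
        (((Ef η f x₀ s hmax R Hs B hE).filter (fun e => j ≤ e)).card : ℝ) +
          (∑ e ∈ (Ef η f x₀ s hmax R Hs B hE).filter (fun e => j ≤ e), Lf η f x₀ s hmax R Hs B hE e) / (μ * s) := by
      intro j; simp only [M, dif_pos hE]
    obtain ⟨hL0, _, hoff, hon⟩ := hspec η f x₀ s hmax R Hs B hE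
    set E := Ef η f x₀ s hmax R Hs B hE with hEdef
    set L := Lf η f x₀ s hmax R Hs B hE with hLdef
    have hsub : ∀ j : ℕ, E.filter (fun e => j + 1 ≤ e) ⊆ E.filter (fun e => j ≤ e) := by
      intro j e he
      rw [Finset.mem_filter] at he ⊢
      exact ⟨he.1, by omega⟩
    refine ⟨?_, ?_, ?_⟩
    · intro j
      rw [hMj]
      have : 0 ≤ ∑ e ∈ E.filter (fun e => j ≤ e), L e := Finset.sum_nonneg fun e _ => hL0 e
      exact add_nonneg (Nat.cast_nonneg _) (div_nonneg this hμs.le)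
    · intro j
      rw [hMj, hMj]
      have hc : ((E.filter (fun e => j + 1 ≤ e)).card : ℝ) ≤ (E.filter (fun e => j ≤ e)).card := by
        exact_mod_cast Finset.card_le_card (hsub j)
      have hsm : (∑ e ∈ E.filter (fun e => j + 1 ≤ e), L e) ≤ ∑ e ∈ E.filter (fun e => j ≤ e), L e :=
        Finset.sum_le_sum_of_subset_of_nonneg (hsub j) fun e _ _ => hL0 e
      have := div_le_div_of_nonneg_right hsm hμs.le
      linarith
    · intro j hj
      obtain ⟨v, hv, hR, hP⟩ := hj
      have hjE : j ∈ E := by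
        by_contra hj
        exact hP (hoff j v hj hv hR)
      refine ⟨L j, hL0 j, fun u hu hRu => hon j u hjE hu hRu, ?_⟩
      rw [hMj, hMj]
      have hins : E.filter (fun e => j ≤ e) = insert j (E.filter (fun e => j + 1 ≤ e)) := by
        ext e
        rw [Finset.mem_insert, Finset.mem_filter, Finset.mem_filter]
        constructor
        · rintro ⟨he, hje⟩
          by_cases h : e = j
          · exact Or.inl h
          · exact Or.inr ⟨he, by omega⟩
        · rintro (rfl | ⟨he, hje⟩)
          · exact ⟨hjE, le_rfl⟩
          · exact ⟨he, by omega⟩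
      have hnot : j ∉ E.filter (fun e => j + 1 ≤ e) := by simp
      rw [hins, Finset.card_insert_of_notMem hnot, Finset.sum_insert hnot, add_div]
      push_cast
      linarith

/-- (β2′) `MonovariantInit M`. -/
def MonovariantInit (M : LevelMeter) : Prop := MonovariantInitG 1 M

/-- (β1′) `MonovariantStep P M` (P = the registered dial; P₀ = `PSealC4` per (CA217)(2)(a)). -/
def MonovariantStep (P : StatePred) (M : LevelMeter) : Prop := MonovariantStepG (1 / 4) P StCol' (CumReady WindowReady) M

/-- ★ (γ′, K) (β2′) ∧ (β1′) ⇒ (β-low) ⇒ (β). -/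
theorem denseLevelCensusStopLow_of_monovariant {P : StatePred} {M : LevelMeter} (hI : MonovariantInit M) (hS : MonovariantStep P M) :
    DenseLevelCensusStopLow P :=
  denseLevelCensusLow_of_monovariant (by norm_num) hI hS

/-- `denseLevelCensusStop_of_monovariant` (W-07 c13 monovariant socket §M; token-identical to C1 MonoSketch-W07c13pre 0448107b). -/
theorem denseLevelCensusStop_of_monovariant {P : StatePred} {M : LevelMeter} (hI : MonovariantInit M) (hS : MonovariantStep P M) :
    DenseLevelCensusStop P :=
  denseLevelCensusStop_of_low' (denseLevelCensusStopLow_of_monovariant hI hS)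

/-- ★★ (K) the cycle-13-shaped chain: (α-low) ∧ (β2′) ∧ (β1′) ⇒ `DescentSigS'`. -/
theorem descentSigS'_of_monovariant {P : StatePred} {M : LevelMeter}
    (hα : IsolatedPairDropLow P) (hI : MonovariantInit M) (hS : MonovariantStep P M) : DescentSigS' :=
  descentSigS'_of_fieldSplitLowLow hα (denseLevelCensusStopLow_of_monovariant hI hS)

/-- (K) and nothing is lost: (β-low) at any dial comes from SOME meter. -/
theorem monovariant_of_denseLevelCensusStopLow {P : StatePred} (h : DenseLevelCensusStopLow P) :
    ∃ M : LevelMeter, MonovariantInit M ∧ MonovariantStep P M :=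
  monovariant_of_denseLevelCensusLow (by norm_num) h

end RhW07.C12.FieldSplit
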